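import Mathlib
import HarnessLib
import Literature.NumberTheory.GaloisRepresentations.ArtinCharacterReciprocityProofs

/-!
# The Hecke character of a transported finite-order `p`-adic Galois character
(crux stmt-Langlands-15111, line Sketch) — helper file (`--supports`), odd-descent-up-to-twist sector

Let `K` be a number field, `ι : ℚ̄_p ≃+* ℂ`, `ψ : Γ_K →ₜ* ℚ̄_pˣ` a continuous character and
`τ : Γ_K →ₜ* GL_1(ℂ)` a rank-one framed Artin representation transporting `ψ⁻¹` along `ι`,
i.e. `τ(g)₀₀ = ι(ψ g)⁻¹` for all `g` (this relation is a hypothesis; it is produced elsewhere).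
**Artin reciprocity for linear characters**, proved in the tree
(`Literature.NumberTheory.GaloisRepresentations.artinReciprocity_character_holds`, global class
field theory: Tate, *Global class field theory*, Cassels–Fröhlich Ch. VII §5.1 Main Theorem (A)
with §4.2 Corollary and §2.1), attaches to `τ` a finite-order Hecke character `ω` of `K` which at
every finite place `v` where `τ` is unramified is unramified with `τ(Φ)₀₀ = ω(ϖ_v)` for every
arithmetic Frobenius `Φ` above `v`.  Unwinding the transport relation:

* at such `v`, `ψ` is trivial on every inertia group above `v` (`τ(g) = 1` forces
  `ι(ψ g)⁻¹ = 1`, and `ι` is injective);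
* `ψ(Φ) = ι⁻¹(ω(ϖ_v)⁻¹)` for every arithmetic Frobenius `Φ` above `v`.

* `stub_existsHeckeCharacterOfTransport` — the statement above.

No definitions.
-/

noncomputable section

open Literature.NumberTheory.GaloisRepresentations

-- `Summit.Langlands.Langlands.…`: summit = sub-problem name (D-0017 nested layout), not a typo.
set_option linter.dupNamespace false

namespace Summit.Langlands.Langlands.Theorems.ArtinWeightRealisationLevel

/-- **The Hecke character of a transported finite-order `p`-adic character.**  For a number field
`K`, `ι : ℚ̄_p ≃+* ℂ`, a continuous character `ψ : Γ_K →ₜ* ℚ̄_pˣ` and a rank-one framed Artin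
representation `τ` with `τ(g)₀₀ = ι(ψ g)⁻¹`, there is a finite-order Hecke character `ω` of `K`
such that at every finite place `v` at which `τ` is unramified: `ψ` kills every inertia group
above `v`, `ω` is unramified at `v`, and `ψ(Φ) = ι⁻¹(ω(ϖ_v)⁻¹)` for every arithmetic Frobenius `Φ`
above `v`.  From Artin reciprocity for linear characters (`artinReciprocity_character_holds`,
through its pointwise form `exists_heckeCharacter_apply_frob_eq`), by transport along `ι`.
[cite: CasselsFrohlichANT1967, Ch. VII §5.1 Main Theorem (A), §4.2 Corollary, §2.1] -/
theorem stub_existsHeckeCharacterOfTransport : ∀ (K : Type) [Field K] [NumberField K] (p : ℕ) [Fact p.Prime] (ι : PadicAlgCl p ≃+* ℂ) (ψ : Field.absoluteGaloisGroup K →ₜ* (PadicAlgCl p)ˣ) (τ : Literature.NumberTheory.GaloisRepresentations.FramedArtinRep K 1), (∀ g : Field.absoluteGaloisGroup K, ((τ g : GL (Fin 1) ℂ) : Matrix (Fin 1) (Fin 1) ℂ) 0 0 = (ι ((ψ g : (PadicAlgCl p)ˣ) : PadicAlgCl p))⁻¹) → ∃ ω : Literature.NumberTheory.GaloisRepresentations.HeckeCharacter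 K, ω.IsFiniteOrder ∧ ∀ v : IsDedekindDomain.HeightOneSpectrum (NumberField.RingOfIntegers K), τ.IsUnramifiedAt v → (∀ 𝔓 ∈ v.primesAbove, ∀ g ∈ 𝔓.inertia (Field.absoluteGaloisGroup K), ψ g = 1) ∧ ω.IsUnramifiedAt v ∧ ∀ 𝔓 ∈ v.primesAbove, ∀ Φ : Field.absoluteGaloisGroup K, IsArithFrobAt (NumberField.RingOfIntegers K) Φ 𝔓 → ((ψ Φ : (PadicAlgCl p)ˣ) : PadicAlgCl p) = ι.symm ((ω.valueAtUniformizer v)⁻¹) := by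
  intro K _ _ p _ ι ψ τ hτ
  obtain ⟨ω, hfin, hω⟩ := exists_heckeCharacter_apply_frob_eq artinReciprocity_character_holds τ
  refine ⟨ω, hfin, fun v hv => ⟨fun 𝔓 h𝔓 g hg => ?_, (hω v hv).1, fun 𝔓 h𝔓 Φ hΦ => ?_⟩⟩
  · -- `τ g = 1` on inertia, so `ι (ψ g)⁻¹ = 1`, so `ψ g = 1` (`ι` is injective).
    have h1 : τ g = 1 := hv 𝔓 h𝔓 g hg
    have h2 := hτ g
    rw [h1, Units.val_one, Matrix.one_apply_eq, eq_comm, inv_eq_one,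
      EmbeddingLike.map_eq_one_iff, Units.val_eq_one] at h2
    exact h2
  · -- `τ Φ = ω(ϖ_v)` at an arithmetic Frobenius, so `ι (ψ Φ)⁻¹ = ω(ϖ_v)`.
    have h := (hω v hv).2 𝔓 h𝔓 Φ hΦ
    rw [hτ Φ] at h
    rw [← h, inv_inv, RingEquiv.symm_apply_apply]

end Summit.Langlands.Langlands.Theorems.ArtinWeightRealisationLevel

end
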